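import Summits.Ventures.HodgeRepro2.T5KernelIdentity
import Summits.Ventures.HodgeRepro2.T5DecompositionTransport
import Summits.Ventures.HodgeRepro2.T5RightCosetAction
import Summits.Ventures.HodgeRepro2.T5CocompactInversion

/-!
# T5RightCosetDecomposition — [DE] Theorem 9.2.2 in [DE]'s OWN convention: `L²(Γ\G)` with the
RIGHT regular representation

Cell pub-hodge-repro2, seat p5, Tier 5 (route/T5-N4-p5.md, N4.3 v13 (B1)–(B2)).  Rows 48–59 prove
the theorem for Mathlib's left cosets `G ⧸ Γ` with the LEFT regular representation
`(L(g)φ)(xΓ) = φ(g⁻¹xΓ)`; [DE] p0234 l. 15 uses the right coset space `Γ\G` with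
`(R(g)φ)(Γx) = φ(Γxg)`.  The inversion `Γx ↦ x⁻¹Γ` (row 40's homeomorphism `rightRelHomeomorph`)
is `G`-EQUIVARIANT for row 44's right regular action `g • Γx = Γxg⁻¹` and the left action on
`G ⧸ Γ` (`ι_smul`), so the pull-back of functions along it is a unitary `L²(Γ\G) ≃ L²(G ⧸ Γ)`
intertwining `R` with `L`, and row 60's transport carries the decomposition over:

* `ι`, `ι_rmk`, `ι_smul`, `ι_symm_smul`: the inversion and its equivariance;
* `rightCosetsMS`, `ιₘ`: the σ-algebra on `Γ\G` transported from `G ⧸ Γ` (the inversion becomes a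
  measurable equivalence), the right action measurable (`instMeasurableConstSMul_rightCosets`);
* `rightMeasure ν := map ι.symm ν`, `G`-invariant when `ν` is (`smulInvariantMeasure_rightMeasure`);
* `pullbackₗᵢ`, `pullback`: the unitary `L²(Γ\G, rightMeasure ν) ≃ₗᵢ[ℂ] L²(G ⧸ Γ, ν)`, `F ↦ F ∘ ι⁻¹`,
  which INTERTWINES the right regular representation with the left one (`intertwines_pullback`);
* `exists_decomposition_rightRegular`: **[DE] Theorem 9.2.2 for `L²(Γ\G)`**: under the
  hypotheses of row 59, `L²(Γ\G, rightMeasure μ_𝓕)` with the right regular representation is the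
  closed orthogonal sum of irreducible closed `G`-stable subspaces with every unitary-equivalence
  class FINITE.

Mathlib only besides rows 36, 40, 44, 53, 56–60.  Axioms: propext, Classical.choice, Quot.sound.
README §8(d): uses an L-value-free non-vanishing device: NO.
-/

namespace Summit.Ventures.HodgeRepro2.T5RightCosetDecomposition

open MeasureTheory
open Summit.Ventures.HodgeRepro2.T5RightCosetAction
open Summit.Ventures.HodgeRepro2.T5CocompactInversion
open Summit.Ventures.HodgeRepro2.T5DecompositionTransport
open Summit.Ventures.HodgeRepro2.T5RegularRep
open Summit.Ventures.HodgeRepro2.T5KernelIdentity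
open Summit.Ventures.HodgeRepro2.T5FiniteMultiplicity (IsUnitaryEquiv)
open Summit.Ventures.HodgeRepro2.T5CompactDiscreteDecomposition (IrreducibleOn)

variable {G : Type*} [Group G] [TopologicalSpace G] [IsTopologicalGroup G] (Γ : Subgroup G)

/-! ### The inversion and its equivariance -/

/-- The inversion `Γ\G → G ⧸ Γ`, `[x] ↦ [x⁻¹]` (row 40's homeomorphism as a function). -/
def ι : RightCosets Γ → G ⧸ Γ := rightRelHomeomorph Γ

/-- `ι` on classes. -/
theorem ι_rmk (x : G) : ι Γ (rmk Γ x) = ((x⁻¹ : G) : G ⧸ Γ) :=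
  rfl

variable {Γ}

/-- **Equivariance** of the inversion: row 44's right regular action `g • [x] = [x g⁻¹]` on `Γ\G`
corresponds to the left action `g • [y] = [g y]` on `G ⧸ Γ`. -/
theorem ι_smul (g : G) (q : RightCosets Γ) : ι Γ (g • q) = g • ι Γ q := by
  refine Quotient.inductionOn' q fun x => ?_
  show ι Γ (g • rmk Γ x) = g • ι Γ (rmk Γ x)
  rw [smul_rmk, ι_rmk, ι_rmk, mul_inv_rev, inv_inv]
  rfl

/-- The inverse of `ι` is equivariant too. -/
theorem ι_symm_smul (g : G) (y : G ⧸ Γ) :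
    (rightRelHomeomorph Γ).symm (g • y) = g • (rightRelHomeomorph Γ).symm y := by
  apply (rightRelHomeomorph Γ).injective
  show ι Γ ((rightRelHomeomorph Γ).symm (g • y)) = ι Γ (g • (rightRelHomeomorph Γ).symm y)
  rw [ι_smul]
  show (rightRelHomeomorph Γ) ((rightRelHomeomorph Γ).symm (g • y)) =
    g • (rightRelHomeomorph Γ) ((rightRelHomeomorph Γ).symm y)
  rw [Homeomorph.apply_symm_apply, Homeomorph.apply_symm_apply]

/-! ### The transported σ-algebra -/

attribute [-instance] Quotient.instMeasurableSpace

variable [MeasurableSpace (G ⧸ Γ)]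

/-- The σ-algebra on `Γ\G` transported from `G ⧸ Γ` along the inversion. -/
@[reducible] def rightCosetsMS : MeasurableSpace (RightCosets Γ) :=
  MeasurableSpace.comap (ι Γ) ‹MeasurableSpace (G ⧸ Γ)›

attribute [local instance] rightCosetsMS

/-- The inversion as a measurable equivalence `Γ\G ≃ᵐ G ⧸ Γ`. -/
def ιₘ : RightCosets Γ ≃ᵐ G ⧸ Γ where
  toEquiv := (rightRelHomeomorph Γ).toEquiv
  measurable_toFun := comap_measurable _
  measurable_invFun := by
    intro s hs
    obtain ⟨t, ht, rfl⟩ := MeasurableSpace.measurableSet_comap.1 hs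
    show MeasurableSet ((rightRelHomeomorph Γ).symm ⁻¹' (ι Γ ⁻¹' t))
    rw [← Set.preimage_comp]
    have h : ι Γ ∘ (rightRelHomeomorph Γ).symm = id := (rightRelHomeomorph Γ).self_comp_symm
    rw [h, Set.preimage_id]
    exact ht

/-- `ιₘ` is `ι` on points. -/
theorem coe_ιₘ : ⇑(ιₘ (Γ := Γ)) = ι Γ :=
  rfl

/-- `ιₘ.symm` is the inverse homeomorphism on points. -/
theorem coe_ιₘ_symm : ⇑(ιₘ (Γ := Γ)).symm = (rightRelHomeomorph Γ).symm :=
  rfl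

/-- A map into `Γ\G` is measurable iff its composite with `ι` is. -/
theorem measurable_to_rightCosets {X : Type*} [MeasurableSpace X] {h : X → RightCosets Γ}
    (hh : Measurable (ι Γ ∘ h)) : Measurable h := by
  intro s hs
  obtain ⟨t, ht, rfl⟩ := MeasurableSpace.measurableSet_comap.1 hs
  rw [← Set.preimage_comp]
  exact hh ht

/-- The right regular action is measurable for the transported σ-algebra (`G ⧸ Γ` Borel). -/
instance instMeasurableConstSMul_rightCosets [MeasurableSpace G] [BorelSpace G]
    [BorelSpace (G ⧸ Γ)] : MeasurableConstSMul G (RightCosets Γ) where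
  measurable_const_smul g := by
    refine measurable_to_rightCosets ?_
    have h : ι Γ ∘ (fun q : RightCosets Γ => g • q) = (fun y => g • y) ∘ ι Γ :=
      funext fun q => ι_smul g q
    rw [h]
    exact (measurable_const_smul g).comp (comap_measurable _)

/-! ### The transported measure -/

variable (ν : Measure (G ⧸ Γ))

/-- The measure on `Γ\G` transported from `ν` along the inversion. -/
noncomputable def rightMeasure : Measure (RightCosets Γ) :=
  Measure.map (ιₘ (Γ := Γ)).symm ν

/-- `ι⁻¹ : (G ⧸ Γ, ν) → (Γ\G, rightMeasure ν)` is measure preserving. -/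
theorem measurePreserving_ιₘ_symm : MeasurePreserving (ιₘ (Γ := Γ)).symm ν (rightMeasure ν) :=
  (ιₘ (Γ := Γ)).symm.measurable.measurePreserving ν

/-- `ι : (Γ\G, rightMeasure ν) → (G ⧸ Γ, ν)` is measure preserving. -/
theorem measurePreserving_ιₘ : MeasurePreserving (ιₘ (Γ := Γ)) (rightMeasure ν) ν := by
  have h := MeasurePreserving.symm (ιₘ (Γ := Γ)).symm (measurePreserving_ιₘ_symm ν)
  simpa only [MeasurableEquiv.symm_symm] using h

/-- `rightMeasure ν` is finite when `ν` is. -/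
instance isFiniteMeasure_rightMeasure [IsFiniteMeasure ν] : IsFiniteMeasure (rightMeasure ν) :=
  Measure.isFiniteMeasure_map ν _

/-- **`G`-invariance** of `rightMeasure ν` for a `G`-invariant `ν` (the inversion is
equivariant). -/
theorem smulInvariantMeasure_rightMeasure [MeasurableSpace G] [BorelSpace G] [BorelSpace (G ⧸ Γ)]
    [SMulInvariantMeasure G (G ⧸ Γ) ν] : SMulInvariantMeasure G (RightCosets Γ) (rightMeasure ν) := by
  refine ⟨fun g s hs => ?_⟩
  rw [rightMeasure, MeasurableEquiv.map_apply, MeasurableEquiv.map_apply]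
  have h : (ιₘ (Γ := Γ)).symm ⁻¹' ((fun q => g • q) ⁻¹' s) =
      (fun y => g • y) ⁻¹' ((ιₘ (Γ := Γ)).symm ⁻¹' s) := by
    ext y
    simp only [Set.mem_preimage, coe_ιₘ_symm, ι_symm_smul]
  rw [h]
  exact SMulInvariantMeasure.measure_preimage_smul g ((ιₘ (Γ := Γ)).symm.measurable hs)

/-! ### The unitary pull-back and the intertwining -/

/-- The pull-back `F ↦ F ∘ ι⁻¹ : L²(Γ\G, rightMeasure ν) → L²(G ⧸ Γ, ν)` as a linear isometry. -/
noncomputable def pullbackₗᵢ : Lp ℂ 2 (rightMeasure ν) →ₗᵢ[ℂ] Lp ℂ 2 ν :=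
  Lp.compMeasurePreservingₗᵢ ℂ (ιₘ (Γ := Γ)).symm (measurePreserving_ιₘ_symm ν)

/-- `pullbackₗᵢ` on points: a.e. `F ∘ ι⁻¹`. -/
theorem coeFn_pullbackₗᵢ (F : Lp ℂ 2 (rightMeasure ν)) :
    (pullbackₗᵢ ν F : G ⧸ Γ → ℂ) =ᵐ[ν] (F : RightCosets Γ → ℂ) ∘ (ιₘ (Γ := Γ)).symm :=
  Lp.coeFn_compMeasurePreserving F _

/-- `pullbackₗᵢ` is surjective (the inverse is the pull-back along `ι`). -/
theorem pullbackₗᵢ_surjective : Function.Surjective (pullbackₗᵢ ν) := by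
  intro H
  refine ⟨Lp.compMeasurePreserving (ιₘ (Γ := Γ)) (measurePreserving_ιₘ ν) H, ?_⟩
  apply Lp.ext
  have h1 := coeFn_pullbackₗᵢ ν (Lp.compMeasurePreserving (ιₘ (Γ := Γ)) (measurePreserving_ιₘ ν) H)
  have h2 : ((Lp.compMeasurePreserving (ιₘ (Γ := Γ)) (measurePreserving_ιₘ ν) H :
      RightCosets Γ → ℂ) ∘ (ιₘ (Γ := Γ)).symm) =ᵐ[ν] ((H : G ⧸ Γ → ℂ) ∘ ιₘ) ∘ (ιₘ (Γ := Γ)).symm :=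
    (measurePreserving_ιₘ_symm ν).quasiMeasurePreserving.ae_eq_comp
      (Lp.coeFn_compMeasurePreserving H _)
  refine h1.trans (h2.trans (Filter.Eventually.of_forall fun y => ?_))
  show (H : G ⧸ Γ → ℂ) (ιₘ ((ιₘ (Γ := Γ)).symm y)) = H y
  rw [MeasurableEquiv.apply_symm_apply]

/-- **The unitary** `L²(Γ\G, rightMeasure ν) ≃ₗᵢ[ℂ] L²(G ⧸ Γ, ν)`. -/
noncomputable def pullback : Lp ℂ 2 (rightMeasure ν) ≃ₗᵢ[ℂ] Lp ℂ 2 ν :=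
  LinearIsometryEquiv.ofSurjective (pullbackₗᵢ ν) (pullbackₗᵢ_surjective ν)

/-- `pullback` is `pullbackₗᵢ` on points. -/
theorem pullback_apply_eq (F : Lp ℂ 2 (rightMeasure ν)) : pullback ν F = pullbackₗᵢ ν F :=
  rfl

/-- **The pull-back intertwines the right regular representation on `L²(Γ\G)` with the left regular
representation on `L²(G ⧸ Γ)`.** -/
theorem intertwines_pullback [MeasurableSpace G] [BorelSpace G] [BorelSpace (G ⧸ Γ)]
    [SMulInvariantMeasure G (G ⧸ Γ) ν] :
    haveI := smulInvariantMeasure_rightMeasure ν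
    IntertwinesRep (regularRep (G := G) (rightMeasure ν)) (regularRep (G := G) ν) (pullback ν) := by
  haveI := smulInvariantMeasure_rightMeasure ν
  intro g F
  rw [pullback_apply_eq, pullback_apply_eq]
  apply Lp.ext
  -- LHS a.e.: `(ρ' g F) ∘ ι⁻¹ = F ∘ (g⁻¹ • ·) ∘ ι⁻¹`
  have hL : (pullbackₗᵢ ν (regularRep (G := G) (rightMeasure ν) g F) : G ⧸ Γ → ℂ) =ᵐ[ν]
      fun y => (F : RightCosets Γ → ℂ) (g⁻¹ • (ιₘ (Γ := Γ)).symm y) :=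
    (coeFn_pullbackₗᵢ ν _).trans
      ((measurePreserving_ιₘ_symm ν).quasiMeasurePreserving.ae_eq_comp
        (coeFn_regularRep_apply (rightMeasure ν) g F))
  -- RHS a.e.: `(ρ g (F ∘ ι⁻¹)) = (F ∘ ι⁻¹) ∘ (g⁻¹ • ·)`
  have hR : (regularRep (G := G) ν g (pullbackₗᵢ ν F) : G ⧸ Γ → ℂ) =ᵐ[ν]
      fun y => (F : RightCosets Γ → ℂ) ((ιₘ (Γ := Γ)).symm (g⁻¹ • y)) :=
    (coeFn_regularRep_apply ν g _).trans
      ((measurePreserving_smul g⁻¹ ν).quasiMeasurePreserving.ae_eq_comp (coeFn_pullbackₗᵢ ν F))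
  refine hL.trans (Filter.EventuallyEq.trans (Filter.Eventually.of_forall fun y => ?_) hR.symm)
  show (F : RightCosets Γ → ℂ) (g⁻¹ • (ιₘ (Γ := Γ)).symm y) =
    (F : RightCosets Γ → ℂ) ((ιₘ (Γ := Γ)).symm (g⁻¹ • y))
  rw [coe_ιₘ_symm, ι_symm_smul]

/-! ### [DE] Theorem 9.2.2 for `L²(Γ\G)` -/

variable [LocallyCompactSpace G] [MeasurableSpace G] [BorelSpace G] [SecondCountableTopology G]
  (μ : Measure G) [BorelSpace (G ⧸ Γ)] [T2Space (G ⧸ Γ)] [CompactSpace (G ⧸ Γ)] {𝓕 : Set G}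

/-- The quotient measure `μ_𝓕 = map mk (μ.restrict 𝓕)`. -/
local notation "μ_𝓕" => Measure.map (@QuotientGroup.mk G _ Γ) (μ.restrict 𝓕)

/-- **[DE] Theorem 9.2.2 in [DE]'s own convention**: under the hypotheses of row 59 (a unimodular
Haar `μ` on a second countable locally compact `G`, a countable `Γ` with `Γ.op` properly
discontinuous, a fundamental domain `𝓕`, a compact Hausdorff quotient, `μ_𝓕` finite and
`G`-invariant), `L²(Γ\G, rightMeasure μ_𝓕)` with the RIGHT regular representation `R` is the
closed orthogonal sum of irreducible closed `R`-stable subspaces, every unitary-equivalence class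
of which is FINITE. -/
theorem exists_decomposition_rightRegular [μ.IsMulLeftInvariant] [μ.IsMulRightInvariant]
    [μ.IsInvInvariant] [μ.IsOpenPosMeasure] [IsFiniteMeasureOnCompacts μ] [Countable Γ]
    [ProperlyDiscontinuousSMul Γ.op G] (h𝓕 : IsFundamentalDomain Γ.op 𝓕 μ)
    [IsFiniteMeasure μ_𝓕] [SMulInvariantMeasure G (G ⧸ Γ) μ_𝓕] :
    haveI := smulInvariantMeasure_rightMeasure μ_𝓕
    ∃ S : Set (Submodule ℂ (Lp ℂ 2 (rightMeasure μ_𝓕))),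
      (∀ U ∈ S, IrreducibleOn (regularRep (G := G) (rightMeasure μ_𝓕)) U) ∧
      S.Pairwise (fun U V => U ⟂ V) ∧ (sSup S).topologicalClosure = ⊤ ∧
      ∀ U₀ ∈ S, {U ∈ S | IsUnitaryEquiv (regularRep (G := G) (rightMeasure μ_𝓕)) U₀ U}.Finite :=
  haveI := smulInvariantMeasure_rightMeasure μ_𝓕
  exists_decomposition_of_intertwines (intertwines_pullback μ_𝓕)
    (exists_decomposition_regularRep_quotient μ h𝓕)

end Summit.Ventures.HodgeRepro2.T5RightCosetDecomposition
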